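/-
Copyright: cell pub-balaban-gaps (YM BLITZ Y1, track G1), seat g1-p2 GEN 9 (unit `pub-balaban-gaps-g1-p2`).  Row (D4) NODE O,
JUNCTION J-3 (multi-level), print's (3.37) presentation `U = e^{X}` with the windows ON `X` (85) — now with PRINT'S ANALYTICITY DATUM:
the configuration enters through the ENTRIES of `X(u)` holomorphically ([B9] p. 407 «analytic function … on the space (3.37)»), and
holomorphy of the transporter entries `(e^{±X(u)})_{ab}` is DERIVED (86 `D4WalkBlockExpHolo`), no longer a datum.  HONEST FRAMING:
`X` is a hypothesis SHAPE (the small field in Bałaban's gauge, NOT produced here from (3.35)–(3.36)); fundamental representation; the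
flat operator is the lineage's scalar model ⊗ 1; (D4) NOT discharged (instance 0∕1); NOT BetaPertH, NOT continuum, NOT Clay.
-/
import Summits.QuantumFields.BalabanUV.Gaps.D4WalkBlockCovariantExpFieldMultiLevel
import Summits.QuantumFields.BalabanUV.Gaps.D4WalkBlockExpHolo

/-!
# `Gaps.D4WalkBlockCovariantExpFieldHoloMultiLevel` — Cor. 3.5 for the Green function of the covariant multi-level operator of
# `U = e^{X}`, windows AND holomorphy on `X` (cell pub-balaban-gaps, seat g1-p2 gen 9)

HONEST DEPENDENCY (cell pub-balaban, verbatim): continuum YM on T⁴ ⇐ BetaPertH ∧ nine spine estimates (0/9 proved);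
BetaPertH ⇐ (D1) ∧ (D4) ∧ CAP+tail.

**`blockWalkExpansion_covariantGreenExp_multiLevelTorus_holo`** = 85's `blockWalkExpansion_covariantGreenExp_multiLevelTorus` with its
two holomorphy data (entries of `u ↦ e^{X ν u y}` and of `u ↦ e^{−X ν u y}` holomorphic on the ball) replaced by the ONE natural datum
«the entries of `u ↦ X ν u y` are holomorphic on the ball» (86's `differentiableOn_exp_entry_family` ∕ `differentiableOn_exp_neg_entry_family`).
So: for EVERY bond field `X` on [4]'s nested family whose entries are holomorphic in the configuration and which sits in print's (3.37)
window (`Σ_c|X_μ(y)_{ac}| ≤ a₀L^{−lev y}`, `Σ_c|(X_μ(x) − X_μ(x − e_μ))_{ac}| ≤ a₁L^{−2lev x}`), the Green function of the covariant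
multi-level operator of `e^{X}` is a block walk expansion with Cor. 3.5's letters, constants uniform in `k`, the torus, `{Ω_j}`, `N`, `Γ`.
WHAT IT IS NOT.  (3.35)–(3.36) ⟹ (3.37); the adjoint representation (89); (D4) instance 0∕1; words of row (D4) UNCHANGED.

References: T. Bałaban, Comm. Math. Phys. **99** (1985) 389–434 [B9], (3.37) p. 396, Cor. 3.5 p. 407; Comm. Math. Phys. **96** (1984) [4],
(2.13)–(2.14) p. 225; Comm. Math. Phys. **116** (1988) [II], p. 15.
-/

noncomputable section

namespace Summit.QuantumFields.BalabanUV.Gaps.D4WalkBlockCovariantExpFieldHoloMultiLevel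

open Metric NormedSpace
open scoped Matrix
open Literature.MathematicalPhysics.QuantumFieldTheory.Balaban1983to89
open Literature.MathematicalPhysics.QuantumFieldTheory.Balaban1983to89.B4Reflection242 (boxDom blk)
open Literature.MathematicalPhysics.QuantumFieldTheory.Balaban1983to89.B9SectDWalk (DomBy)
open Literature.MathematicalPhysics.QuantumFieldTheory.Balaban1983to89.B9Thm34Ext (toB6)
open Literature.MathematicalPhysics.QuantumFieldTheory.Balaban1983to89.B9Thm37GlueTorus (torusGeom tdist1)
open Literature.MathematicalPhysics.QuantumFieldTheory.Balaban1983to89.TreeLengthTorus (TPt)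
open Literature.MathematicalPhysics.QuantumFieldTheory.Balaban1983to89.B5TorusCover (UT)
open Literature.MathematicalPhysics.QuantumFieldTheory.Balaban1983to89.B11SectG (RowSum)
open Literature.MathematicalPhysics.QuantumFieldTheory.Balaban1983to89.B6MultiLevelBoxOperator (N0)
open Literature.MathematicalPhysics.QuantumFieldTheory.Balaban1983to89.B6MultiLevelTorusOperator (TDomains gmlT tshift unitVec)
open Literature.MathematicalPhysics.QuantumFieldTheory.Balaban1983to89.B6Ineq243TwoLevelBox (aNext)
open Summit.QuantumFields.BalabanUV.Gaps.D4WalkBlock (blockNorm BlockWalkExpansion)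
open Summit.QuantumFields.BalabanUV.Gaps.D4WalkBlockMultiLevelGeometry (cubeML)
open Summit.QuantumFields.BalabanUV.Gaps.D4WalkBlockTransportAlgebra (rowSumNorm)
open Summit.QuantumFields.BalabanUV.Gaps.D4WalkBlockShiftStep (covLap)
open Summit.QuantumFields.BalabanUV.Gaps.D4WalkBlockShiftWeighted (covDopW covBW covAlphaW)
open Summit.QuantumFields.BalabanUV.Gaps.D4WalkBlockWeightedLettersMultiLevel (levW)
open Summit.QuantumFields.BalabanUV.Gaps.D4WalkBlockCovariantAveragingMultiLevel (covAvgOp)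
open Summit.QuantumFields.BalabanUV.Gaps.D4WalkBlockCovariantContourMultiLevel (contourT contourTi)
open Summit.QuantumFields.BalabanUV.Gaps.D4WalkBlockCovariantExpFieldMultiLevel (blockWalkExpansion_covariantGreenExp_multiLevelTorus)
open Summit.QuantumFields.BalabanUV.Gaps.D4WalkBlockExpHolo (differentiableOn_exp_entry_family differentiableOn_exp_neg_entry_family)

variable {d : ℕ}

section Green

variable {dd N' : ℕ} {E : Type*} [NormedAddCommGroup E] [NormedSpace ℂ E]

/-- **[B9] COR. 3.5 FOR THE GREEN FUNCTION OF THE COVARIANT MULTI-LEVEL OPERATOR OF `U = e^{X}`, WINDOWS AND HOLOMORPHY ON `X`.**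
85's theorem with the single analyticity datum «the entries of `u ↦ X ν u y` are holomorphic on the ball»; the transporter entries
`(e^{±X ν u y})_{ab}` are then holomorphic by `D4WalkBlockExpHolo`.
[cite: Balaban1985BackgroundPropagators, Cor. 3.5 p.407, (3.37) p.396, (3.62)–(3.64) p.402, (3.78) p.406; Balaban1984PropagatorsII, (2.13)–(2.14) p.225; Balaban1988RG2Cluster, (1.11) p.5, p.15] -/
theorem blockWalkExpansion_covariantGreenExp_multiLevelTorus_holo (d ℓ : ℕ) (hℓ : 1 ≤ ℓ) (aminus aplus a2minus a2plus : ℝ)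
    (ha : 0 < aminus) (ha2 : 0 < a2minus) :
    ∃ δ₁ C M₀ : ℝ, ∃ N₀ : ℕ, 0 < δ₁ ∧ 0 < C ∧ 0 < M₀ ∧ 0 < N₀ ∧
      ∀ (k Mh R : ℕ), 3 ≤ Mh → M₀ ≤ ((ℓ : ℝ) + 1) * Mh → 2 * (ℓ + 1) ≤ R → N₀ + 1 ≤ R * ((ℓ + 1) * Mh) →
      ∀ (P : Fin (d + 1) → ℕ) (hP : ∀ μ, 1 ≤ P μ) (hP4 : ∀ μ, 4 ≤ P μ) (D : TDomains d ℓ Mh k P R) (a c : ℕ → ℝ),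
        (∀ i, 1 ≤ i → aminus ≤ a i ∧ a i ≤ aplus) → (∀ i, 1 ≤ i → a2minus ≤ c i ∧ c i ≤ a2plus) →
        (∀ i, 1 ≤ i → a (i + 1) = aNext ℓ (a i) (c i)) →
      ∀ (Kc : Fin (d + 1) → ℕ) [∀ i, NeZero (Kc i)], (∀ i, N0 ℓ Mh k P i = (ℓ + 1) ^ k * Kc i) →
      ∀ (N : ℕ) (c₀ : B13.Consts) (Xs : Finset (UT Kc)) (Rb : ℝ)
        (X : Fin (d + 1) → E → ↥(boxDom (N0 ℓ Mh k P)) → Matrix (Fin N) (Fin N) ℂ)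
        (Γ : ↥(boxDom (N0 ℓ Mh k P)) → List (↥(boxDom (N0 ℓ Mh k P)) × Fin (d + 1))) (a₀ a₁ ε μ cμ : ℝ),
      (∀ ν y a' b, DifferentiableOn ℂ (fun u => X ν u y a' b) (ball (0 : E) Rb)) →
      0 ≤ a₀ → 0 ≤ a₁ →
      (∀ ν, ∀ u ∈ ball (0 : E) Rb, ∀ y a', rowSumNorm (X ν u y) a' ≤ a₀ * ((((ℓ : ℝ) + 1) ^ D.lev y.1))⁻¹) →
      (∀ ν, ∀ u ∈ ball (0 : E) Rb, ∀ x a', rowSumNorm (X ν u x - X ν u ((tshift (N0 ℓ Mh k P) (unitVec ν)).symm x)) a' ≤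
        a₁ * ((((ℓ : ℝ) + 1) ^ D.lev x.1))⁻¹ ^ 2) →
      (∀ x, (Γ x).length ≤ (d + 1) * (ℓ + 1) ^ D.lev x.1) →
      (∀ x, ∀ b ∈ Γ x, blk ((ℓ + 1) ^ D.lev x.1) b.1.1 = blk ((ℓ + 1) ^ D.lev x.1) x.1) →
      0 ≤ μ → 2 * μ ≤ ε → 2 * μ ≤ δ₁ - ε - μ → 0 ≤ cμ →
      RowSum (toB6 (torusGeom Kc 0 0 0) 0 True) μ cμ →
      cμ * (cμ * 1 * (1 * ((0 + ∑ j : Unit ⊕ (Fin (d + 1) ⊕ Fin (d + 1)),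
        covAlphaW (((ℓ : ℝ) + 1) * (a₀ * Real.exp a₀)) (((d : ℝ) + 1) * (a₁ * Real.exp (((ℓ : ℝ) + 1) * a₀) +
          (((ℓ : ℝ) + 1) * (a₀ * Real.exp a₀)) ^ 2) + aplus * (Real.exp (2 * ((d : ℝ) + 1) * (a₀ * Real.exp a₀)) - 1)) j * covBW δ₁ ((ℓ : ℝ) + 1) j) * C)) * cμ) * cμ < 1 →
      ∃ (W : Type) (T : W → (TPt dd N' → ℂ) → E → Matrix (↥(boxDom (N0 ℓ Mh k P)) × Fin N) (↥(boxDom (N0 ℓ Mh k P)) × Fin N) ℂ)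
        (SX' : Set W) (A' : W → ℝ) (D' : W → UT Kc → UT Kc → ℝ),
        BlockWalkExpansion c₀ (fun q : ↥(boxDom (N0 ℓ Mh k P)) × Fin N => cubeML ℓ k Kc q.1.1)
          (fun q : ↥(boxDom (N0 ℓ Mh k P)) × Fin N => cubeML ℓ k Kc q.1.1)
          (fun (_ : TPt dd N' → ℂ) u =>
            (covLap ↥(boxDom (N0 ℓ Mh k P)) (Fin N) (fun ν => tshift (N0 ℓ Mh k P) (unitVec ν)) ((((ℓ : ℝ) + 1) ^ k)⁻¹)
                (fun ν u x => exp (X ν u x) - 1) (fun ν u x => exp (-X ν u ((tshift (N0 ℓ Mh k P) (unitVec ν)).symm x)) - 1) u +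
              (((ℓ : ℂ) + 1) ^ (2 * k) : ℂ) • covAvgOp D a (contourT Γ fun u b => exp (X b.2 u b.1)) (contourTi Γ fun u b => exp (-X b.2 u b.1)) u)⁻¹)
          Xs Rb (ε - 2 * μ) (δ₁ - ε - μ - 2 * μ)
          (cμ * C * (1 * (1 - cμ * (cμ * 1 * (1 * ((0 + ∑ j : Unit ⊕ (Fin (d + 1) ⊕ Fin (d + 1)),
            covAlphaW (((ℓ : ℝ) + 1) * (a₀ * Real.exp a₀)) (((d : ℝ) + 1) * (a₁ * Real.exp (((ℓ : ℝ) + 1) * a₀) +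
              (((ℓ : ℝ) + 1) * (a₀ * Real.exp a₀)) ^ 2) + aplus * (Real.exp (2 * ((d : ℝ) + 1) * (a₀ * Real.exp a₀)) - 1)) j * covBW δ₁ ((ℓ : ℝ) + 1) j) * C)) * cμ) * cμ)⁻¹) * cμ)
          T SX' A' D' (δ₁ - 2 * μ) ∧
        (∀ (j : Unit ⊕ (Fin (d + 1) ⊕ Fin (d + 1))) ω (σ : TPt dd N' → ℂ), (∀ i, ‖σ i‖ ≤ Real.exp c₀.κ₁) →
          ∀ u ∈ ball (0 : E) Rb, ∀ Y Y',
          blockNorm (fun q : ↥(boxDom (N0 ℓ Mh k P)) × Fin N => cubeML ℓ k Kc q.1.1)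
              (fun q : ↥(boxDom (N0 ℓ Mh k P)) × Fin N => cubeML ℓ k Kc q.1.1)
              (covDopW ↥(boxDom (N0 ℓ Mh k P)) (Fin N) (fun ν => tshift (N0 ℓ Mh k P) (unitVec ν)) ((((ℓ : ℝ) + 1) ^ k)⁻¹) (levW D) j *
                T ω σ u) Y Y' ≤
            covBW (ι := Fin (d + 1)) δ₁ ((ℓ : ℝ) + 1) j * (A' ω * Real.exp (-((δ₁ - 2 * μ) * D' ω Y Y')))) ∧
        ∀ ω, DomBy (toB6 (torusGeom Kc 0 0 0) 0 True) (D' ω) := by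
  obtain ⟨δ₁, C, M₀, N₀, hδ₁, hC, hM₀, hN₀, hmain⟩ :=
    blockWalkExpansion_covariantGreenExp_multiLevelTorus (dd := dd) (N' := N') (E := E) d ℓ hℓ aminus aplus a2minus a2plus ha ha2
  refine ⟨δ₁, C, M₀, N₀, hδ₁, hC, hM₀, hN₀, ?_⟩
  intro k Mh R hMh hM hR hRM P hP hP4 D a c haw hcw hac Kc _ hKc N c₀ Xs Rb X Γ a₀ a₁ ε μ cμ hXh
  exact hmain k Mh R hMh hM hR hRM P hP hP4 D a c haw hcw hac Kc hKc N c₀ Xs Rb X Γ a₀ a₁ ε μ cμ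
    (differentiableOn_exp_entry_family hXh) (differentiableOn_exp_neg_entry_family hXh)

end Green

end Summit.QuantumFields.BalabanUV.Gaps.D4WalkBlockCovariantExpFieldHoloMultiLevel

end
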